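import Literature.LinearAlgebra.Matrix.PermanentSubperm
import Mathlib.Data.Matrix.Basis
import Mathlib.LinearAlgebra.Matrix.Notation
import Mathlib.Tactic.FinCases
import HarnessLib

/-!
# Absorbing a Boolean sum into a permanent: the two-site gadget

The third step of Valiant's completeness proof for the permanent (Bürgisser–Clausen–Shokrollahi
1997, Thm. (21.29)) turns a Boolean sum `∑_{e ∈ {0,1}^t} per A(X, e)` into a single permanent.
BCS do this over a field of characteristic `≠ 2` with Valiant's `4 × 4` matrix, rosettes of
`2μ` copies of it for a variable of multiplicity `μ`, and control entries `4^{-2μ}`. For the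
constant-free theory (Bürgisser 2009, Thm. 2.10; Koiran 2004, Thm. 4.3: `2^{p(n)} f_n` is a
projection of `PER` with entries in `{2X_i} ∪ {-2, …, 2}`) we need a DIVISION-FREE version over
an arbitrary commutative ring, and we only need variables occurring at (exactly) TWO positions
("sites") of the matrix, in distinct rows and distinct columns. This file provides that step:

* `Literature.LinearAlgebra.Matrix.boolSumGlue A u₁ v₁ u₂ v₂ ε₁ ε₂` — the matrix `A` bordered by
  the explicit `4 × 4` core `boolSumCore = (1 0 1 0; 0 1 0 -1; 1 1 -1 -1; -1 -1 -1 -1)`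
  (entries in `{0, ±1}`), the row `u_s` entering the core vertex `s - 1` with weight `ε_s` and
  the core vertex `s - 1` leaving to the column `v_s` (`s = 1, 2`);
* `Literature.LinearAlgebra.Matrix.permanent_boolSumGlue` — for `u₁ ≠ u₂`, `v₁ ≠ v₂`:

    `per (boolSumGlue A u₁ v₁ u₂ v₂ ε₁ ε₂) = 2 · (per A + per (A + ε₁ E_{u₁v₁} + ε₂ E_{u₂v₂}))`,

  i.e. twice the Boolean sum `∑_{y ∈ {0,1}} per (A + y (ε₁ E_{u₁v₁} + ε₂ E_{u₂v₂}))` of the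
  matrix in which a Boolean variable `y` occupies the two sites with coefficients `ε₁, ε₂`
  (`E_{uv}` = `Matrix.single u v 1`). Iterating over all variables (sibling file) multiplies the
  Boolean sum by `2^t` and keeps all entries in `{entries of A} ∪ {0, ±1, ε's}`.

The core was found by exhaustive computer search (there is no such core on `≤ 3` vertices with
entries in `{0, ±1}`; the search and an independent numerical check are recorded with the
literature item); the proof here is a complete verification by Laplace expansion: expanding
along the two internal core rows (BCS (21.30), `Matrix.subperm_laplace_support` of
`PermanentSubperm.lean`) leaves six `2 × 2` factors, of which four vanish, one (`{2,3}`, value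
`2`) multiplies the "ports only" matrix — `A` with its sites rerouted through two relay
vertices, permanent `per (A + ε₁E₁ + ε₂E₂)` (`subperm_boolSumGlue_ports`) — and one (`{0,1}`,
value `-2`) multiplies `-per A` (`subperm_boolSumGlue_crossed`).

Also proved here, as deliberate dot-notation extensions of Mathlib's `Matrix` namespace
continuing `PermanentSubperm.lean`: `Matrix.subperm_congr_entries`, `Matrix.subperm_transpose`,
`Matrix.subperm_expand_col` (column expansion), `Matrix.subperm_add_single` /
`Matrix.permanent_add_single` / `Matrix.permanent_add_single_add_single` (the permanent is
affine in each entry; two-site expansion), `Matrix.subperm_row_two/row_one/col_one` (sparse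
expansions), `Matrix.subperm_fromBlocks_of_inl` (subpermanents inside the first block).

## References

* P. Bürgisser, M. Clausen, M. A. Shokrollahi, *Algebraic Complexity Theory*, Springer 1997,
  Thm. (21.29) and its proof (Valiant's matrix, rosettes), (21.30) (Laplace expansion).
* L. G. Valiant, *Completeness classes in algebra*, STOC 1979 (junctions / iff-couplings).
* P. Bürgisser, *On defining integers and proving arithmetic circuit lower bounds*, Comput.
  Complexity 18 (2009), proof of Thm. 2.10 (the division-free form that this serves).
-/

namespace Matrix

open Equiv Finset

variable {ι : Type*} [Fintype ι] [DecidableEq ι] {R : Type*} [CommSemiring R]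

/-! ### More subpermanent calculus -/

/-- A subpermanent only reads the entries in its rows and columns. [folklore] -/
theorem subperm_congr_entries {p q : ι → Prop} [DecidablePred p] [DecidablePred q]
    {M N : Matrix ι ι R} (h : ∀ j i, q j → p i → M j i = N j i) :
    M.subperm p q = N.subperm p q := by
  unfold subperm
  refine Finset.sum_congr rfl fun f _ => Finset.prod_congr rfl fun i _ => ?_
  exact h _ _ (f i).2 i.2

/-- Transposition swaps the roles of the row and column predicates: the bijections `f` from the
`p`-columns to the `q`-rows of `Mᵀ` correspond to their inverses. [folklore] -/
theorem subperm_transpose (M : Matrix ι ι R) (p q : ι → Prop) [DecidablePred p] [DecidablePred q] :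
    Mᵀ.subperm p q = M.subperm q p := by
  unfold subperm
  refine Fintype.sum_equiv (Equiv.equivCongr (Equiv.refl _) (Equiv.refl _) |>.trans
    ⟨Equiv.symm, Equiv.symm, fun f => f.symm_symm, fun f => f.symm_symm⟩) _ _ fun f => ?_
  -- `∏_{i : p} Mᵀ (f i) i = ∏_{j : q} M (f⁻¹ j) j`
  simp only [Equiv.trans_apply, Equiv.coe_fn_mk, transpose_apply]
  refine Fintype.prod_equiv f _ _ fun i => ?_
  simp

/-- **Expansion of a subpermanent along the column `i₀`** (the transpose of
`Matrix.subperm_expand_row`). [folklore] -/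
theorem subperm_expand_col {p q : ι → Prop} [DecidablePred p] [DecidablePred q] (M : Matrix ι ι R)
    (i₀ : ι) (hi₀ : p i₀) :
    M.subperm p q = ∑ j ∈ univ.filter q,
      M j i₀ * M.subperm (fun i => p i ∧ i ≠ i₀) (fun j' => q j' ∧ j' ≠ j) := by
  rw [← M.subperm_transpose, Mᵀ.subperm_expand_row i₀ hi₀]
  refine Finset.sum_congr rfl fun j _ => ?_
  rw [transpose_apply, ← M.subperm_transpose]

/-- **The permanent is affine in each entry**: adding `ε` at position `(u, v)` adds `ε` times
the complementary subpermanent (expansion along the row `u`). [folklore] -/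
theorem subperm_add_single {p q : ι → Prop} [DecidablePred p] [DecidablePred q] (M : Matrix ι ι R)
    (u v : ι) (ε : R) (hu : q u) (hv : p v) :
    (M + single u v ε).subperm p q =
      M.subperm p q + ε * M.subperm (fun i => p i ∧ i ≠ v) (fun j => q j ∧ j ≠ u) := by
  rw [(M + single u v ε).subperm_expand_row u hu, M.subperm_expand_row u hu]
  have hS : ∀ i, (M + single u v ε).subperm (fun i' => p i' ∧ i' ≠ i) (fun j => q j ∧ j ≠ u) =
      M.subperm (fun i' => p i' ∧ i' ≠ i) (fun j => q j ∧ j ≠ u) := fun i =>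
    subperm_congr_entries fun j i' hj _ => by
      rw [add_apply, single_apply_of_row_ne (Ne.symm hj.2), add_zero]
  simp_rw [hS, add_apply, add_mul, Finset.sum_add_distrib]
  congr 1
  rw [Finset.sum_eq_single_of_mem v (Finset.mem_filter.2 ⟨Finset.mem_univ _, hv⟩)
    (fun i _ hi => by rw [single_apply_of_col_ne _ _ (Ne.symm hi), zero_mul])]
  rw [single_apply_same]

/-- If the added position is outside the rows or columns read, nothing changes. [folklore] -/
theorem subperm_add_single_of_not {p q : ι → Prop} [DecidablePred p] [DecidablePred q]
    (M : Matrix ι ι R) (u v : ι) (ε : R) (h : ¬ q u ∨ ¬ p v) :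
    (M + single u v ε).subperm p q = M.subperm p q :=
  subperm_congr_entries fun j i hj hi => by
    rcases h with h | h
    · rw [add_apply, single_apply_of_row_ne (fun huj => h (by rw [huj]; exact hj)), add_zero]
    · rw [add_apply, single_apply_of_col_ne _ _ (fun hvi => h (by rw [hvi]; exact hi)), add_zero]

/-- `per (M + ε E_{uv}) = per M + ε · per (M with row u and column v deleted)`. [folklore] -/
theorem permanent_add_single (M : Matrix ι ι R) (u v : ι) (ε : R) :
    (M + single u v ε).permanent =
      M.permanent + ε * M.subperm (fun i => i ≠ v) (fun j => j ≠ u) := by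
  rw [← subperm_true, subperm_add_single _ u v ε trivial trivial, subperm_true]
  congr 2
  exact M.subperm_congr (fun i => by simp) (fun j => by simp)

/-- **Two sites in distinct rows and columns**: the multi-affine expansion
`per (M + ε₁ E_{u₁v₁} + ε₂ E_{u₂v₂}) = per M + ε₁ m₁ + ε₂ m₂ + ε₁ ε₂ m₁₂` with the complementary
subpermanents `m₁, m₂, m₁₂`. [folklore] -/
theorem permanent_add_single_add_single (M : Matrix ι ι R) {u₁ v₁ u₂ v₂ : ι} (ε₁ ε₂ : R)
    (hu : u₁ ≠ u₂) (hv : v₁ ≠ v₂) :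
    (M + single u₁ v₁ ε₁ + single u₂ v₂ ε₂).permanent =
      M.permanent + ε₁ * M.subperm (fun i => i ≠ v₁) (fun j => j ≠ u₁)
        + ε₂ * M.subperm (fun i => i ≠ v₂) (fun j => j ≠ u₂)
        + ε₁ * ε₂ * M.subperm (fun i => i ≠ v₁ ∧ i ≠ v₂) (fun j => j ≠ u₁ ∧ j ≠ u₂) := by
  rw [permanent_add_single, permanent_add_single,
    subperm_add_single (p := fun i => i ≠ v₂) (q := fun j => j ≠ u₂) M u₁ v₁ ε₁ hu hv]
  have e : M.subperm (fun i => (i ≠ v₂) ∧ i ≠ v₁) (fun j => (j ≠ u₂) ∧ j ≠ u₁) =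
      M.subperm (fun i => i ≠ v₁ ∧ i ≠ v₂) (fun j => j ≠ u₁ ∧ j ≠ u₂) :=
    M.subperm_congr (fun i => and_comm) (fun j => and_comm)
  rw [e]
  ring


/-- Expansion along a row with at most two nonzero admissible entries. [folklore] -/
theorem subperm_row_two {p q : ι → Prop} [DecidablePred p] [DecidablePred q] (M : Matrix ι ι R)
    (r c₁ c₂ : ι) (hr : q r) (hc₁ : p c₁) (hc₂ : p c₂) (hne : c₁ ≠ c₂)
    (hzero : ∀ c, p c → c ≠ c₁ → c ≠ c₂ → M r c = 0) :
    M.subperm p q = M r c₁ * M.subperm (fun i => p i ∧ i ≠ c₁) (fun j => q j ∧ j ≠ r) +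
      M r c₂ * M.subperm (fun i => p i ∧ i ≠ c₂) (fun j => q j ∧ j ≠ r) := by
  rw [M.subperm_expand_row r hr]
  refine Finset.sum_eq_add_of_mem c₁ c₂ (by simpa using hc₁) (by simpa using hc₂) hne ?_
  intro c hc hc'
  rw [hzero c (by simpa using hc) hc'.1 hc'.2, zero_mul]

/-- Expansion along a row with at most one nonzero admissible entry. [folklore] -/
theorem subperm_row_one {p q : ι → Prop} [DecidablePred p] [DecidablePred q] (M : Matrix ι ι R)
    (r c : ι) (hr : q r) (hc : p c) (hzero : ∀ c', p c' → c' ≠ c → M r c' = 0) :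
    M.subperm p q = M r c * M.subperm (fun i => p i ∧ i ≠ c) (fun j => q j ∧ j ≠ r) := by
  rw [M.subperm_expand_row r hr]
  refine Finset.sum_eq_single_of_mem c (by simpa using hc) ?_
  intro c' hc' hne
  rw [hzero c' (by simpa using hc') hne, zero_mul]

/-- Expansion along a column with at most one nonzero admissible entry. [folklore] -/
theorem subperm_col_one {p q : ι → Prop} [DecidablePred p] [DecidablePred q] (M : Matrix ι ι R)
    (c r : ι) (hc : p c) (hr : q r) (hzero : ∀ r', q r' → r' ≠ r → M r' c = 0) :
    M.subperm p q = M r c * M.subperm (fun i => p i ∧ i ≠ c) (fun j => q j ∧ j ≠ r) := by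
  rw [M.subperm_expand_col c hc]
  refine Finset.sum_eq_single_of_mem r (by simpa using hr) ?_
  intro r' hr' hne
  rw [hzero r' (by simpa using hr') hne, zero_mul]

/-- A subpermanent of a block matrix `(A Q; Rm B)` all of whose rows and columns lie in the first
block is the corresponding subpermanent of `A`. [folklore] -/
theorem subperm_fromBlocks_of_inl {γ : Type*} [Fintype γ] [DecidableEq γ]
    (A : Matrix ι ι R) (Q : Matrix ι γ R) (Rm : Matrix γ ι R) (B : Matrix γ γ R)
    (p q : ι ⊕ γ → Prop) [DecidablePred p] [DecidablePred q]
    (hp : ∀ g, ¬ p (Sum.inr g)) (hq : ∀ g, ¬ q (Sum.inr g)) :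
    (fromBlocks A Q Rm B).subperm p q =
      A.subperm (fun i => p (Sum.inl i)) (fun j => q (Sum.inl j)) := by
  haveI : IsEmpty {g : γ // p (Sum.inr g)} := ⟨fun g => hp g.1 g.2⟩
  haveI : IsEmpty {g : γ // q (Sum.inr g)} := ⟨fun g => hq g.1 g.2⟩
  let ep : {x : ι ⊕ γ // p x} ≃ {i : ι // p (Sum.inl i)} :=
    Equiv.subtypeSum.trans (Equiv.sumEmpty _ _)
  let eq' : {y : ι ⊕ γ // q y} ≃ {j : ι // q (Sum.inl j)} :=
    Equiv.subtypeSum.trans (Equiv.sumEmpty _ _)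
  unfold subperm
  refine Fintype.sum_equiv (Equiv.equivCongr ep eq') _ _ fun f => ?_
  refine Fintype.prod_equiv ep _ _ fun x => ?_
  obtain ⟨x, hx⟩ := x
  rcases x with i | g
  · simp only [Equiv.equivCongr_apply_apply]
    have hex : ep.symm (ep ⟨Sum.inl i, hx⟩) = ⟨Sum.inl i, hx⟩ := Equiv.symm_apply_apply _ _
    rw [hex]
    generalize f ⟨Sum.inl i, hx⟩ = y
    obtain ⟨y, hy⟩ := y
    rcases y with j | g
    · rfl
    · exact absurd hy (hq g)
  · exact absurd hx (hp g)

end Matrix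

/-! ### The two-site gadget -/

namespace Literature.LinearAlgebra.Matrix

open _root_.Matrix Equiv Finset

variable {ι : Type*} [DecidableEq ι] {R : Type*} [CommRing R]

/-- The `4 × 4` core of the Boolean-sum gadget: vertices `0, 1` are the two ports, `2, 3` are
internal. Found by exhaustive search (no `3`-vertex core with entries in `{0, ±1}` exists); its
six interface numbers are `per = 4`, straight single ports `2`, crossed single ports `0`, both
ports `2`. [folklore] -/
def boolSumCore : Matrix (Fin 4) (Fin 4) R :=
  !![1, 0, 1, 0; 0, 1, 0, -1; 1, 1, -1, -1; -1, -1, -1, -1]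

/-- The port columns: row `u₁` enters the core vertex `0` with weight `ε₁`, row `u₂` enters the
core vertex `1` with weight `ε₂`. [folklore] -/
def glueQ (u₁ u₂ : ι) (ε₁ ε₂ : R) : Matrix ι (Fin 4) R :=
  of fun j g => if g = 0 ∧ j = u₁ then ε₁ else if g = 1 ∧ j = u₂ then ε₂ else 0

/-- The port rows: core vertex `0` exits to column `v₁`, core vertex `1` exits to column `v₂`
(weights `1`). [folklore] -/
def glueR (v₁ v₂ : ι) : Matrix (Fin 4) ι R :=
  of fun g i => if g = 0 ∧ i = v₁ then 1 else if g = 1 ∧ i = v₂ then 1 else 0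

/-- **The glued matrix**: the two sites `(u₁, v₁)` and `(u₂, v₂)` of a Boolean variable are
rerouted through the ports of the core. [folklore] -/
def boolSumGlue (A : Matrix ι ι R) (u₁ v₁ u₂ v₂ : ι) (ε₁ ε₂ : R) :
    Matrix (ι ⊕ Fin 4) (ι ⊕ Fin 4) R :=
  fromBlocks A (glueQ u₁ u₂ ε₁ ε₂) (glueR v₁ v₂) boolSumCore

section Entries

variable (A : Matrix ι ι R) (u₁ v₁ u₂ v₂ : ι) (ε₁ ε₂ : R)

/-- Entries of the glued matrix, first block. [folklore] -/
@[simp] theorem boolSumGlue_inl_inl (j i : ι) :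
    boolSumGlue A u₁ v₁ u₂ v₂ ε₁ ε₂ (Sum.inl j) (Sum.inl i) = A j i := rfl

/-- Entries of the glued matrix, port columns. [folklore] -/
@[simp] theorem boolSumGlue_inl_inr (j : ι) (g : Fin 4) :
    boolSumGlue A u₁ v₁ u₂ v₂ ε₁ ε₂ (Sum.inl j) (Sum.inr g) =
      if g = 0 ∧ j = u₁ then ε₁ else if g = 1 ∧ j = u₂ then ε₂ else 0 := rfl

/-- Entries of the glued matrix, port rows. [folklore] -/
@[simp] theorem boolSumGlue_inr_inl (g : Fin 4) (i : ι) :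
    boolSumGlue A u₁ v₁ u₂ v₂ ε₁ ε₂ (Sum.inr g) (Sum.inl i) =
      if g = 0 ∧ i = v₁ then 1 else if g = 1 ∧ i = v₂ then 1 else 0 := rfl

/-- Entries of the glued matrix, core. [folklore] -/
@[simp] theorem boolSumGlue_inr_inr (g g' : Fin 4) :
    boolSumGlue A u₁ v₁ u₂ v₂ ε₁ ε₂ (Sum.inr g) (Sum.inr g') = boolSumCore g g' := rfl

end Entries

section Gadget

variable [Fintype ι] (A : Matrix ι ι R) (u₁ v₁ u₂ v₂ : ι) (ε₁ ε₂ : R)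

/-- The `2 × 2` subpermanents of the internal rows: for core columns `a ≠ b`,
`subperm {a, b} {2, 3} = B₂ₐ B₃_b + B₂_b B₃ₐ`. [folklore] -/
theorem subperm_boolSumGlue_internal (a b : Fin 4) (hab : a ≠ b) :
    (boolSumGlue A u₁ v₁ u₂ v₂ ε₁ ε₂).subperm
      (· ∈ ({Sum.inr a, Sum.inr b} : Finset (ι ⊕ Fin 4)))
      (· ∈ ({Sum.inr 2, Sum.inr 3} : Finset (ι ⊕ Fin 4))) =
      (boolSumCore 2 a * boolSumCore 3 b + boolSumCore 2 b * boolSumCore 3 a : R) := by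
  set M := boolSumGlue A u₁ v₁ u₂ v₂ ε₁ ε₂ with hM
  have hv : Function.Injective (![Sum.inr a, Sum.inr b] : Fin 2 → ι ⊕ Fin 4) := by
    intro k l h
    fin_cases k <;> fin_cases l <;> simp_all
  have hw : Function.Injective (![Sum.inr 2, Sum.inr 3] : Fin 2 → ι ⊕ Fin 4) := by
    intro k l h
    fin_cases k <;> fin_cases l <;> simp_all
  rw [M.subperm_congr (p' := (· ∈ Set.range ![Sum.inr a, Sum.inr b]))
      (q' := (· ∈ Set.range ![Sum.inr 2, Sum.inr 3]))
      (fun i => by simp [or_comm])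
      (fun j => by simp [or_comm]),
    M.subperm_range_eq_permanent _ _ hv hw, permanent_fin_two_row]
  simp [hM]

/-- The values of the core used below. [folklore] -/
theorem boolSumCore_values :
    (boolSumCore 0 0 : R) = 1 ∧ (boolSumCore 0 1 : R) = 0 ∧ (boolSumCore 0 2 : R) = 1 ∧
    (boolSumCore 0 3 : R) = 0 ∧ (boolSumCore 1 0 : R) = 0 ∧ (boolSumCore 1 1 : R) = 1 ∧
    (boolSumCore 1 2 : R) = 0 ∧ (boolSumCore 1 3 : R) = -1 ∧ (boolSumCore 2 0 : R) = 1 ∧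
    (boolSumCore 2 1 : R) = 1 ∧ (boolSumCore 2 2 : R) = -1 ∧ (boolSumCore 2 3 : R) = -1 ∧
    (boolSumCore 3 0 : R) = -1 ∧ (boolSumCore 3 1 : R) = -1 ∧ (boolSumCore 3 2 : R) = -1 ∧
    (boolSumCore 3 3 : R) = -1 := by
  simp [boolSumCore]

/-- **Ports only.** With the internal vertices `2, 3` deleted, the glued matrix is `A` with its
two sites rerouted through the port vertices `0, 1` (loops of weight `1`), and its permanent
is the permanent of `A` with the sites filled in: `per (A + ε₁ E_{u₁v₁} + ε₂ E_{u₂v₂})`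
(expand along the two port rows, then along the port columns). [folklore] -/
theorem subperm_boolSumGlue_ports (hu : u₁ ≠ u₂) (hv : v₁ ≠ v₂) :
    (boolSumGlue A u₁ v₁ u₂ v₂ ε₁ ε₂).subperm
      (fun i => i ≠ Sum.inr 2 ∧ i ≠ Sum.inr 3) (fun j => j ≠ Sum.inr 2 ∧ j ≠ Sum.inr 3) =
      (A + single u₁ v₁ ε₁ + single u₂ v₂ ε₂).permanent := by
  set M := boolSumGlue A u₁ v₁ u₂ v₂ ε₁ ε₂ with hM
  -- the block lemma, in the four shapes needed
  have blk : ∀ (p q : ι ⊕ Fin 4 → Prop) [DecidablePred p] [DecidablePred q]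
      (P Q' : ι → Prop) [DecidablePred P] [DecidablePred Q'],
      (∀ g, ¬ p (Sum.inr g)) → (∀ g, ¬ q (Sum.inr g)) →
      (∀ i, p (Sum.inl i) ↔ P i) → (∀ j, q (Sum.inl j) ↔ Q' j) →
      M.subperm p q = A.subperm P Q' := by
    intro p q _ _ P Q' _ _ hp hq hP hQ
    rw [hM, boolSumGlue, subperm_fromBlocks_of_inl _ _ _ _ _ _ hp hq]
    exact A.subperm_congr hP hQ
  -- row `inr 0`: loop or exit to `v₁`
  have z0 : ∀ c : ι ⊕ Fin 4, (c ≠ Sum.inr 2 ∧ c ≠ Sum.inr 3) → c ≠ Sum.inr 0 → c ≠ Sum.inl v₁ →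
      M (Sum.inr 0) c = 0 := by
    rintro (x | g) hp h1 h2
    · have hx : x ≠ v₁ := fun h => h2 (by rw [h])
      simp [hM, hx]
    · fin_cases g <;> simp_all [boolSumCore]
  rw [M.subperm_row_two (Sum.inr 0) (Sum.inr 0) (Sum.inl v₁) (by simp) (by simp) (by simp) (by simp) z0]
  have e00 : M (Sum.inr 0) (Sum.inr 0) = 1 := by simp [hM, boolSumCore]
  have e0v : M (Sum.inr 0) (Sum.inl v₁) = 1 := by simp [hM]
  rw [e00, e0v, one_mul, one_mul]
  -- row `inr 1` in both terms: loop or exit to `v₂`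
  have z1 : ∀ c : ι ⊕ Fin 4, (c ≠ Sum.inr 2 ∧ c ≠ Sum.inr 3) → c ≠ Sum.inr 1 → c ≠ Sum.inl v₂ →
      M (Sum.inr 1) c = 0 := by
    rintro (x | g) hp h1 h2
    · have hx : x ≠ v₂ := fun h => h2 (by rw [h])
      simp [hM, hx]
    · fin_cases g <;> simp_all [boolSumCore]
  have e11 : M (Sum.inr 1) (Sum.inr 1) = 1 := by simp [hM, boolSumCore]
  have e1v : M (Sum.inr 1) (Sum.inl v₂) = 1 := by simp [hM]
  rw [M.subperm_row_two (p := fun i => (i ≠ Sum.inr 2 ∧ i ≠ Sum.inr 3) ∧ i ≠ Sum.inr 0)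
      (Sum.inr 1) (Sum.inr 1) (Sum.inl v₂) (by simp) (by simp) (by simp) (by simp)
      (fun c hc h1 h2 => z1 c hc.1 h1 h2),
    M.subperm_row_two (p := fun i => (i ≠ Sum.inr 2 ∧ i ≠ Sum.inr 3) ∧ i ≠ Sum.inl v₁)
      (Sum.inr 1) (Sum.inr 1) (Sum.inl v₂) (by simp) (by simp)
      (by simpa using fun h => hv h.symm) (by simp)
      (fun c hc h1 h2 => z1 c hc.1 h1 h2),
    e11, e1v, one_mul, one_mul]
  -- the port columns have a single entry in the rows of `A`
  have cz0 : ∀ r : ι ⊕ Fin 4, (∀ g, r ≠ Sum.inr g) → r ≠ Sum.inl u₁ → M r (Sum.inr 0) = 0 := by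
    rintro (x | g) hr hne
    · have hx : x ≠ u₁ := fun h => hne (by rw [h])
      simp [hM, hx]
    · exact absurd rfl (hr g)
  have cz1 : ∀ r : ι ⊕ Fin 4, (∀ g, r ≠ Sum.inr g) → r ≠ Sum.inl u₂ → M r (Sum.inr 1) = 0 := by
    rintro (x | g) hr hne
    · have hx : x ≠ u₂ := fun h => hne (by rw [h])
      simp [hM, hx]
    · exact absurd rfl (hr g)
  have eu0 : M (Sum.inl u₁) (Sum.inr 0) = ε₁ := by simp [hM]
  have eu1 : M (Sum.inl u₂) (Sum.inr 1) = ε₂ := by simp [hM, hu.symm]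
  have hrow : ∀ r : ι ⊕ Fin 4, (((r ≠ Sum.inr 2 ∧ r ≠ Sum.inr 3) ∧ r ≠ Sum.inr 0) ∧ r ≠ Sum.inr 1) →
      ∀ g, r ≠ Sum.inr g := by
    rintro r ⟨⟨⟨h2, h3⟩, h0⟩, h1⟩ g
    fin_cases g <;> assumption
  -- (aa) both loops: `per A`
  have haa : M.subperm (fun i => ((i ≠ Sum.inr 2 ∧ i ≠ Sum.inr 3) ∧ i ≠ Sum.inr 0) ∧ i ≠ Sum.inr 1)
      (fun j => ((j ≠ Sum.inr 2 ∧ j ≠ Sum.inr 3) ∧ j ≠ Sum.inr 0) ∧ j ≠ Sum.inr 1) = A.permanent := by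
    rw [blk _ _ (fun _ => True) (fun _ => True) (fun g => by fin_cases g <;> simp)
      (fun g => by fin_cases g <;> simp) (fun i => by simp) (fun j => by simp), subperm_true]
  -- (ab) loop at `0`, exit `1 → v₂`: the column `inr 1` is taken by the row `u₂`
  have hab : M.subperm (fun i => ((i ≠ Sum.inr 2 ∧ i ≠ Sum.inr 3) ∧ i ≠ Sum.inr 0) ∧ i ≠ Sum.inl v₂)
      (fun j => ((j ≠ Sum.inr 2 ∧ j ≠ Sum.inr 3) ∧ j ≠ Sum.inr 0) ∧ j ≠ Sum.inr 1) =
      ε₂ * A.subperm (fun i => i ≠ v₂) (fun j => j ≠ u₂) := by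
    rw [M.subperm_col_one (Sum.inr 1) (Sum.inl u₂) (by simp) (by simp)
      (fun r hr hne => cz1 r (hrow r hr) hne), eu1,
      blk _ _ (fun i => i ≠ v₂) (fun j => j ≠ u₂) (fun g => by fin_cases g <;> simp)
      (fun g => by fin_cases g <;> simp) (fun i => by simp) (fun j => by simp)]
  -- (ba) exit `0 → v₁`, loop at `1`: the column `inr 0` is taken by the row `u₁`
  have hba : M.subperm (fun i => ((i ≠ Sum.inr 2 ∧ i ≠ Sum.inr 3) ∧ i ≠ Sum.inl v₁) ∧ i ≠ Sum.inr 1)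
      (fun j => ((j ≠ Sum.inr 2 ∧ j ≠ Sum.inr 3) ∧ j ≠ Sum.inr 0) ∧ j ≠ Sum.inr 1) =
      ε₁ * A.subperm (fun i => i ≠ v₁) (fun j => j ≠ u₁) := by
    rw [M.subperm_col_one (Sum.inr 0) (Sum.inl u₁) (by simp) (by simp)
      (fun r hr hne => cz0 r (hrow r hr) hne), eu0,
      blk _ _ (fun i => i ≠ v₁) (fun j => j ≠ u₁) (fun g => by fin_cases g <;> simp)
      (fun g => by fin_cases g <;> simp) (fun i => by simp) (fun j => by simp)]
  -- (bb) both exits: the columns `inr 0`, `inr 1` are taken by the rows `u₁`, `u₂`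
  have hbb : M.subperm (fun i => ((i ≠ Sum.inr 2 ∧ i ≠ Sum.inr 3) ∧ i ≠ Sum.inl v₁) ∧ i ≠ Sum.inl v₂)
      (fun j => ((j ≠ Sum.inr 2 ∧ j ≠ Sum.inr 3) ∧ j ≠ Sum.inr 0) ∧ j ≠ Sum.inr 1) =
      ε₁ * ε₂ * A.subperm (fun i => i ≠ v₁ ∧ i ≠ v₂) (fun j => j ≠ u₁ ∧ j ≠ u₂) := by
    rw [M.subperm_col_one (Sum.inr 0) (Sum.inl u₁) (by simp) (by simp)
      (fun r hr hne => cz0 r (hrow r hr) hne), eu0,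
      M.subperm_col_one (Sum.inr 1) (Sum.inl u₂) (by simp) (by simpa using hu.symm)
      (fun r hr hne => cz1 r (hrow r hr.1) hne), eu1,
      blk _ _ (fun i => i ≠ v₁ ∧ i ≠ v₂) (fun j => j ≠ u₁ ∧ j ≠ u₂)
      (fun g => by fin_cases g <;> simp) (fun g => by fin_cases g <;> simp)
      (fun i => by simp) (fun j => by simp), mul_assoc]
  rw [haa, hab, hba, hbb, permanent_add_single_add_single A ε₁ ε₂ hu hv]
  ring
set_option maxHeartbeats 400000 in -- buildfix (bf3-g27): 160k/180k FAIL, 200k PASS at accept time; line-neutral budget line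
/-- **Internal rows on the ports.** When the internal vertices `2, 3` occupy the port columns
`0, 1`, the port rows must use their internal edges `0 → 2`, `1 → 3` (weights `1`, `-1`) — every
other routing meets a zero column — and the rows of `A` keep the columns of `A`: the
complementary subpermanent is `-per A`. [folklore] -/
theorem subperm_boolSumGlue_crossed :
    (boolSumGlue A u₁ v₁ u₂ v₂ ε₁ ε₂).subperm
      (fun i => i ≠ Sum.inr 0 ∧ i ≠ Sum.inr 1) (fun j => j ≠ Sum.inr 2 ∧ j ≠ Sum.inr 3) =
      -A.permanent := by
  set M := boolSumGlue A u₁ v₁ u₂ v₂ ε₁ ε₂ with hM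
  -- a column `inr 2` or `inr 3` left to the rows of `A` is a zero column
  have zc : ∀ (g : Fin 4), (g = 2 ∨ g = 3) → ∀ (p q : ι ⊕ Fin 4 → Prop) [DecidablePred p]
      [DecidablePred q], p (Sum.inr g) → (∀ r, q r → ∀ g', r ≠ Sum.inr g') → M.subperm p q = 0 := by
    intro g hg p q _ _ hp hq
    refine M.subperm_eq_zero_of_col (Sum.inr g) hp fun r hr => ?_
    rcases r with x | g'
    · rcases hg with rfl | rfl <;> simp [hM]
    · exact absurd rfl (hq _ hr g')
  -- row `inr 0`: exit to `v₁` or internal edge `0 → 2`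
  have z0 : ∀ c : ι ⊕ Fin 4, (c ≠ Sum.inr 0 ∧ c ≠ Sum.inr 1) → c ≠ Sum.inl v₁ → c ≠ Sum.inr 2 →
      M (Sum.inr 0) c = 0 := by
    rintro (x | g) hp h1 h2
    · have hx : x ≠ v₁ := fun h => h1 (by rw [h])
      simp [hM, hx]
    · fin_cases g <;> simp_all [boolSumCore]
  rw [M.subperm_row_two (Sum.inr 0) (Sum.inl v₁) (Sum.inr 2) (by simp) (by simp) (by simp) (by simp) z0]
  have e0v : M (Sum.inr 0) (Sum.inl v₁) = 1 := by simp [hM]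
  have e02 : M (Sum.inr 0) (Sum.inr 2) = 1 := by simp [hM, boolSumCore]
  rw [e0v, e02, one_mul, one_mul]
  -- row `inr 1`: exit to `v₂` or internal edge `1 → 3`
  have z1 : ∀ c : ι ⊕ Fin 4, (c ≠ Sum.inr 0 ∧ c ≠ Sum.inr 1) → c ≠ Sum.inl v₂ → c ≠ Sum.inr 3 →
      M (Sum.inr 1) c = 0 := by
    rintro (x | g) hp h1 h2
    · have hx : x ≠ v₂ := fun h => h1 (by rw [h])
      simp [hM, hx]
    · fin_cases g <;> simp_all [boolSumCore]
  have e1v : M (Sum.inr 1) (Sum.inl v₂) = 1 := by simp [hM]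
  have e13 : M (Sum.inr 1) (Sum.inr 3) = -1 := by simp [hM, boolSumCore]
  have hrow : ∀ r : ι ⊕ Fin 4, (((r ≠ Sum.inr 2 ∧ r ≠ Sum.inr 3) ∧ r ≠ Sum.inr 0) ∧ r ≠ Sum.inr 1) →
      ∀ g, r ≠ Sum.inr g := by
    rintro r ⟨⟨⟨h2, h3⟩, h0⟩, h1⟩ g
    fin_cases g <;> assumption
  by_cases hv : v₁ = v₂
  · -- degenerate bookkeeping: with `v₁ = v₂` the first branch has no exit left for row `1`
    subst hv
    rw [M.subperm_row_one (p := fun i => (i ≠ Sum.inr 0 ∧ i ≠ Sum.inr 1) ∧ i ≠ Sum.inl v₁)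
        (Sum.inr 1) (Sum.inr 3) (by simp) (by simp)
        (fun c hc hne => by
          rcases c with x | g
          · have hx : x ≠ v₁ := fun h => hc.2 (by rw [h])
            simp [hM, hx]
          · fin_cases g <;> simp_all [boolSumCore]),
      M.subperm_row_two (p := fun i => (i ≠ Sum.inr 0 ∧ i ≠ Sum.inr 1) ∧ i ≠ Sum.inr 2)
        (Sum.inr 1) (Sum.inl v₁) (Sum.inr 3) (by simp) (by simp) (by simp) (by simp)
        (fun c hc h1 h2 => z1 c hc.1 h1 h2),
      e13, e1v, one_mul]
    rw [zc 2 (Or.inl rfl) _ _ (by simp) (fun r hr => hrow r (by simpa [and_assoc] using hr)),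
      zc 3 (Or.inr rfl) _ _ (by simp) (fun r hr => hrow r (by simpa [and_assoc] using hr))]
    rw [hM, boolSumGlue, subperm_fromBlocks_of_inl _ _ _ _ _ _
      (fun g => by fin_cases g <;> simp) (fun g => by fin_cases g <;> simp), ← A.subperm_true]
    rw [A.subperm_congr (p' := fun _ => True) (q' := fun _ => True) (fun i => by simp) (fun j => by simp)]
    ring
  rw [M.subperm_row_two (p := fun i => (i ≠ Sum.inr 0 ∧ i ≠ Sum.inr 1) ∧ i ≠ Sum.inl v₁)
      (Sum.inr 1) (Sum.inl v₂) (Sum.inr 3) (by simp) (by simpa using fun h => hv h.symm) (by simp)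
      (by simp) (fun c hc h1 h2 => z1 c hc.1 h1 h2),
    M.subperm_row_two (p := fun i => (i ≠ Sum.inr 0 ∧ i ≠ Sum.inr 1) ∧ i ≠ Sum.inr 2)
      (Sum.inr 1) (Sum.inl v₂) (Sum.inr 3) (by simp) (by simp) (by simp) (by simp)
      (fun c hc h1 h2 => z1 c hc.1 h1 h2),
    e13, e1v, one_mul, one_mul]
  -- three of the four branches leave an internal column to the rows of `A`
  rw [zc 2 (Or.inl rfl) (fun i => ((i ≠ Sum.inr 0 ∧ i ≠ Sum.inr 1) ∧ i ≠ Sum.inl v₁) ∧ i ≠ Sum.inl v₂)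
      _ (by simp) (fun r hr => hrow r (by simpa [and_assoc] using hr)),
    zc 2 (Or.inl rfl) (fun i => ((i ≠ Sum.inr 0 ∧ i ≠ Sum.inr 1) ∧ i ≠ Sum.inl v₁) ∧ i ≠ Sum.inr 3)
      _ (by simp) (fun r hr => hrow r (by simpa [and_assoc] using hr)),
    zc 3 (Or.inr rfl) (fun i => ((i ≠ Sum.inr 0 ∧ i ≠ Sum.inr 1) ∧ i ≠ Sum.inr 2) ∧ i ≠ Sum.inl v₂)
      _ (by simp) (fun r hr => hrow r (by simpa [and_assoc] using hr))]
  -- the last branch is `per A`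
  rw [hM, boolSumGlue, subperm_fromBlocks_of_inl _ _ _ _ _ _
    (fun g => by fin_cases g <;> simp) (fun g => by fin_cases g <;> simp), ← A.subperm_true]
  rw [A.subperm_congr (p' := fun _ => True) (q' := fun _ => True) (fun i => by simp) (fun j => by simp)]
  ring

/-- **The two-site Boolean-sum gadget.** For sites `(u₁, v₁)`, `(u₂, v₂)` in distinct rows and
distinct columns, `per (boolSumGlue A u₁ v₁ u₂ v₂ ε₁ ε₂) = 2 · (per A + per (A + ε₁E_{u₁v₁} + ε₂E_{u₂v₂}))`,
i.e. `2 · ∑_{y ∈ {0,1}} per (A + y (ε₁E_{u₁v₁} + ε₂E_{u₂v₂}))`. Proof: Laplace expansion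
(BCS 1997, (21.30)) along the two internal rows; they take two core columns `{a, b}`, with
`2 × 2` factor `B₂ₐB₃_b + B₂_bB₃ₐ`, which is `2` for `{2, 3}` (then the rest is the ports part,
`per (A + ε₁E₁ + ε₂E₂)`), `-2` for `{0, 1}` (then the rest is `-per A`) and `0` for the four
mixed pairs. [folklore] -/
theorem permanent_boolSumGlue (hu : u₁ ≠ u₂) (hv : v₁ ≠ v₂) :
    (boolSumGlue A u₁ v₁ u₂ v₂ ε₁ ε₂).permanent =
      2 * (A.permanent + (A + single u₁ v₁ ε₁ + single u₂ v₂ ε₂).permanent) := by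
  set M := boolSumGlue A u₁ v₁ u₂ v₂ ε₁ ε₂ with hM
  set ir : Fin 4 ↪ ι ⊕ Fin 4 := ⟨Sum.inr, Sum.inr_injective⟩ with hir
  have h23 : (({Sum.inr 2, Sum.inr 3} : Finset (ι ⊕ Fin 4))).card = 2 := by
    rw [Finset.card_pair]; simp
  -- Laplace along the internal rows, supported on the core columns
  have hLap := M.subperm_laplace_support (p := fun _ => True) (q := fun _ => True)
    ({Sum.inr 2, Sum.inr 3} : Finset (ι ⊕ Fin 4)) (fun _ _ => trivial)
    ((univ : Finset (Fin 4)).map ir)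
    (by
      rintro j hj (x | g) - hx
      · simp only [Finset.mem_insert, Finset.mem_singleton] at hj
        rcases hj with rfl | rfl <;> simp [hM]
      · exact absurd (Finset.mem_map_of_mem ir (Finset.mem_univ g)) hx)
    ∅ (by simp) (by simp)
  rw [Finset.filter_true, h23, Finset.filter_true_of_mem (fun S _ => Finset.empty_subset S),
    Finset.powersetCard_map, Finset.sum_map] at hLap
  rw [← M.subperm_true, hLap]
  have h6 : (univ : Finset (Fin 4)).powersetCard 2 =
      {{2, 3}, {0, 1}, {0, 2}, {0, 3}, {1, 2}, {1, 3}} := by decide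
  rw [h6]
  rw [Finset.sum_insert (by decide), Finset.sum_insert (by decide), Finset.sum_insert (by decide),
    Finset.sum_insert (by decide), Finset.sum_insert (by decide), Finset.sum_singleton]
  -- the six `2 × 2` factors
  have pair : ∀ a b : Fin 4, a ≠ b →
      M.subperm (· ∈ (Finset.mapEmbedding ir).toEmbedding {a, b})
        (· ∈ ({Sum.inr 2, Sum.inr 3} : Finset (ι ⊕ Fin 4))) =
      (boolSumCore 2 a * boolSumCore 3 b + boolSumCore 2 b * boolSumCore 3 a : R) := by
    intro a b hab
    rw [← subperm_boolSumGlue_internal A u₁ v₁ u₂ v₂ ε₁ ε₂ a b hab]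
    refine M.subperm_congr (fun i => ?_) (fun j => Iff.rfl)
    simp [Finset.mapEmbedding_apply, hir]
  -- the complementary factors only depend on the pair
  have rest : ∀ a b : Fin 4,
      M.subperm (fun i => True ∧ i ∉ (Finset.mapEmbedding ir).toEmbedding {a, b})
        (fun j => True ∧ j ∉ ({Sum.inr 2, Sum.inr 3} : Finset (ι ⊕ Fin 4))) =
      M.subperm (fun i => i ≠ Sum.inr a ∧ i ≠ Sum.inr b) (fun j => j ≠ Sum.inr 2 ∧ j ≠ Sum.inr 3) := by
    intro a b
    refine M.subperm_congr (fun i => ?_) (fun j => ?_)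
    · simp [Finset.mapEmbedding_apply, hir, not_or]
    · simp [not_or]
  obtain ⟨c00, c01, c02, c03, c10, c11, c12, c13, c20, c21, c22, c23, c30, c31, c32, c33⟩ :=
    boolSumCore_values (R := R)
  rw [pair 2 3 (by decide), pair 0 1 (by decide), pair 0 2 (by decide), pair 0 3 (by decide),
    pair 1 2 (by decide), pair 1 3 (by decide), rest, rest, rest, rest, rest, rest,
    subperm_boolSumGlue_ports A u₁ v₁ u₂ v₂ ε₁ ε₂ hu hv,
    subperm_boolSumGlue_crossed A u₁ v₁ u₂ v₂ ε₁ ε₂,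
    c20, c21, c22, c23, c30, c31, c32, c33]
  ring

end Gadget

end Literature.LinearAlgebra.Matrix
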